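import Summits.NavierStokesRegularity.NavierStokesRegularity.Theorems.ScenarioCensusAgeingMeter
import Summits.NavierStokesRegularity.NavierStokesRegularity.Theorems.ScenarioCensusSilenceMeterRows
import HarnessLib

/-!
# AGEING METER port, part 2/5: §D the master law (asymptotic recurrence on one receding similarity ball is excluded); §E the universal ageing floor (compactness upgrade; the N1 datum)

Re-homed for the scenario census (typer seat ns-census-typer-1 g10; the cells A2agT / A2agV / A2ag0 / A2agU / A2agFf / A2ag2v are MEMBERS OF RECORD «DECIDED IN KERNEL IN FILES» of row
A2 (item 77: REV 1 critic PASS tier B, REV 3 idea-crit-3 g10 ROW WORDS BY KEY 11:55:14Z; ref PRE-CHECK ✓ §18.27 / §18.37; lead label), A2agF OPEN ≡ D7; this port makes the decided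
cells TREE-decided): VERBATIM PORT of ns-idea-2 LINE g17-2 «ageing-meter» REV 3, `pub/ideators/ns-idea-2/lines/ageing-meter/line-ageing-meter.rev3.lean` sha16 a9c9c668d639c4c6
(1173 l., lean check rc 0, 0 sorry), split for the 400-line rule into `ScenarioCensusAgeingMeter` (§A–§C) → `…AgeingMeterLaw` (§D–§E) → `…AgeingMeterRows` (§F–§G) →
`…AgeingMeterVertex` (§F′) → `…AgeingMeterTwoVertex` (§F″, §H + census KEYS).  Lean text VERBATIM in namespace `…Theorems.ScenarioCensus.AgeingMeter` (the line's
`…Lines.AgeingMeter` re-homed); port edits: the line's `local notation "E3"` is spelled as the reducible `abbrev E3` of every census file; declarations the line restates VERBATIM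
from the landed SILENCE METER (`simBall`, `simBall_neg_one`, `smul_mem_simBall`, `e₀`, `norm_e₀`) and HULL METER (`pastPart`, `pastPart_of_neg`, `pastPart_of_not_neg`,
`isTypeIAncientMild_pastPart`, `isDiscretelySelfSimilar_pastPart`, `PastInvariant`, `PastLiouville`) ports are taken BY NAME (gate lint dedup.landed); `set_option
linter.unusedVariables false` dropped (binders the linter names are `_`-prefixed); `@[conjecture]` on the OPEN row `Row_A2agF` (≡ census D7); one-line docstrings added where missing
(gate lint).  Statements untouched.

No census VALUE is moved here (row A2 stays OPEN-WITH-LINE; the members become TREE-decided by name); D7 / (L′) are NOT proved; no summit statement is proved by this file. Lemmas that restate already-landed tree declarations are taken BY NAME (gate lint `dedup.landed`): `simBall` = `SilenceMeter.simBall`, `smul_mem_simBall` = `SilenceMeter.smul_mem_simBall`, `e₀` = `SilenceMeter.e₀`, `pastPart` = `HullMeter.pastPart`, `isTypeIAncientMild_pastPart` = `HullMeter.isTypeIAncientMild_pastPart`, `isDiscretelySelfSimilar_pastPart` = `HullMeter.isDiscretelySelfSimilar_pastPart`, `PastInvariant` = `HullMeter.PastInvariant`, `PastLiouville` = `Hu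llMeter.PastLiouville`.
-/

-- the summit and its single problem share the name `NavierStokesRegularity` (D-0017 nested layout)
set_option linter.dupNamespace false

noncomputable section

open Set Function Filter Metric
open scoped Topology
open Literature.Analysis Literature.Analysis.FluidPDE
open Summit.NavierStokesRegularity.NavierStokesRegularity.Theorems
open Summit.NavierStokesRegularity.NavierStokesRegularity.Theorems.ScenarioCensus.ScrewBlowdown
open Summit.NavierStokesRegularity.NavierStokesRegularity.Theorems.NearExtremalTransiencePerFlow.FilamentSelection
open Summit.NavierStokesRegularity.NavierStokesRegularity.Cruxes.ScarEnvelopeTypeI.AxisActivity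

namespace Summit.NavierStokesRegularity.NavierStokesRegularity.Theorems.ScenarioCensus.AgeingMeter

variable {C : ℝ} {u : ℝ → E3 → E3}

/-! ## D. The master law: asymptotic recurrence on one receding similarity ball is excluded -/

/-- From defects tending to zero to an exact co-moved recurrence of the limit. -/
theorem recurrence_of_tendsto {v : ℕ → ℝ → E3 → E3} {V : ℝ → E3 → E3} (hV : IsTypeIAncientMild C V)
    (hloc : ∀ t < (0 : ℝ), TendstoLocallyUniformly (fun j => v j t) (V t) atTop)
    (L : E3 ≃ₗᵢ[ℝ] E3) (b : E3) {δ : ℝ} (hδ : 0 < δ) {ε : ℕ → ℝ} (hε : Tendsto ε atTop (𝓝 0)) {x : E3}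
    (hread : ∀ j, ‖v j (-1 - δ) (L x + b) - L (v j (-1) x)‖ ≤ ε j) :
    L.symm (V (-1 - δ) (L x + b)) = V (-1) x := by
  have hT : (-1 - δ : ℝ) < 0 := by linarith
  have hA : Tendsto (fun j => v j (-1 - δ) (L x + b)) atTop (𝓝 (V (-1 - δ) (L x + b))) :=
    (hloc _ hT).tendsto_comp (hV.continuous_slice hT).continuousAt tendsto_const_nhds
  have hB : Tendsto (fun j => L (v j (-1) x)) atTop (𝓝 (L (V (-1) x))) :=
    (L.continuous.tendsto _).comp
      ((hloc (-1) (by norm_num)).tendsto_comp (hV.continuous_slice (by norm_num)).continuousAt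
        tendsto_const_nhds)
  have hle : ‖V (-1 - δ) (L x + b) - L (V (-1) x)‖ ≤ 0 :=
    le_of_tendsto_of_tendsto' (hA.sub hB).norm hε hread
  have heq : V (-1 - δ) (L x + b) = L (V (-1) x) := sub_eq_zero.1 (norm_le_zero_iff.1 hle)
  rw [heq, L.symm_apply_apply]

/-- Blow-down along `μ_k = √(−s_k)`: the limit's slice at `−1 − δ`, co-moved, IS its slice at `−1` on the
similarity ball `B̄(η₀, ρ)`. -/
theorem exists_blowdownLimit_of_recursAlong (hu : IsTypeIAncientMild C u) {L : E3 ≃ₗᵢ[ℝ] E3} {b : E3}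
    {δ : ℝ} (hδ : 0 < δ) {η₀ : E3} {ρ : ℝ} {s : ℕ → ℝ} (hs : RecursAlong u L b δ η₀ ρ s) :
    ∃ W, IsBlowdownLimit C u W ∧ ∀ x ∈ Metric.closedBall η₀ ρ, L.symm (W (-1 - δ) (L x + b)) = W (-1) x := by
  obtain ⟨hs0, hslim, ε, hε, hq⟩ := hs
  set μ : ℕ → ℝ := fun k => Real.sqrt (-s k) with hμdef
  have hμpos : ∀ k, 0 < μ k := fun k => Real.sqrt_pos.2 (by linarith [hs0 k])
  have hμsq : ∀ k, μ k ^ 2 = -s k := fun k => Real.sq_sqrt (by linarith [hs0 k])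
  have hμlim : Tendsto μ atTop atTop := by
    have h1 : Tendsto (fun k => -s k) atTop atTop := tendsto_neg_atBot_atTop.comp hslim
    refine tendsto_atTop_atTop.2 fun B => ?_
    obtain ⟨N, hN⟩ := tendsto_atTop_atTop.1 h1 (B ^ 2)
    refine ⟨N, fun k hk => (le_abs_self B).trans ?_⟩
    rw [← Real.sqrt_sq_eq_abs]
    exact Real.sqrt_le_sqrt (hN k hk)
  obtain ⟨φ, hφ, W, hW, -, -, hloc, -⟩ :=
    exists_tendsto_of_isTypeIAncientMild_seq C (w := fun k => nsRescale (μ k) u)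
      fun k => zoom_isTypeIAncientMild hu (hμpos k)
  have hBD : IsBlowdownLimit C u W :=
    ⟨hW, fun j => μ (φ j), fun j => hμpos _, hμlim.comp hφ.tendsto_atTop, fun t ht => hloc t ht⟩
  refine ⟨W, hBD, fun x hx => ?_⟩
  have hread : ∀ k, ‖nsRescale (μ k) u (-1 - δ) (L x + b) - L (nsRescale (μ k) u (-1) x)‖ ≤ ε k := by
    intro k
    have hmem : μ k • x ∈ SilenceMeter.simBall η₀ ρ (μ k ^ 2 * (-1)) := by
      have hx' : x ∈ SilenceMeter.simBall η₀ ρ (-1) := by rwa [SilenceMeter.simBall_neg_one]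
      exact SilenceMeter.smul_mem_simBall (hμpos k) (by norm_num) hx'
    have ht : μ k ^ 2 * (-1 : ℝ) = s k := by rw [hμsq]; ring
    rw [← reading_neg_one, reading_nsRescale L b δ (hμpos k), ht]
    rw [ht] at hmem
    exact hq k _ hmem
  exact recurrence_of_tendsto hW hloc L b hδ (hε.comp hφ.tendsto_atTop) fun j => hread (φ j)

/-- **MASTER LAW** (PROVED): a Type-I ancient mild field whose ageing readings (lag `δ > 0`, any co-motion
`(L, b)`) on ONE receding similarity ball `√(−s_k)·B̄(η₀, ρ)` (`ρ > 0`, any centre) tend to zero along ONE sequence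
of far-past times `s_k → −∞` is identically zero on the past. -/
theorem eq_zero_of_recursAlong (hu : IsTypeIAncientMild C u) {L : E3 ≃ₗᵢ[ℝ] E3} {b : E3} {δ : ℝ}
    (hδ : 0 < δ) {η₀ : E3} {ρ : ℝ} (hρ : 0 < ρ) {s : ℕ → ℝ} (hs : RecursAlong u L b δ η₀ ρ s) :
    ∀ t < 0, ∀ x, u t x = 0 := by
  obtain ⟨W, hW, hrec⟩ := exists_blowdownLimit_of_recursAlong hu hδ hs
  have hW0 : ∀ t < 0, ∀ x, W t x = 0 :=
    eq_zero_of_comotionRecurrent hW.1 L b hδ (t₀ := -1) (by norm_num) Metric.isOpen_ball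
      ⟨η₀, Metric.mem_ball_self hρ⟩ fun x hx => hrec x (Metric.ball_subset_closedBall hx)
  exact eq_zero_of_blowdownLimit_zero hu hW hW0

/-- The «before every time there is a more recurrent time» form yields a recurring sequence. -/
theorem recursAlong_of_forall {L : E3 ≃ₗᵢ[ℝ] E3} {b : E3} {δ : ℝ} {η₀ : E3} {ρ : ℝ}
    (h : ∀ f > (0 : ℝ), ∀ T < (0 : ℝ), ∃ s < T, ∀ z ∈ SilenceMeter.simBall η₀ ρ s, reading L b δ u s z ≤ f) :
    ∃ s : ℕ → ℝ, RecursAlong u L b δ η₀ ρ s := by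
  have h' : ∀ k : ℕ, ∃ s < -((k : ℝ) + 1), ∀ z ∈ SilenceMeter.simBall η₀ ρ s, reading L b δ u s z ≤ 1 / ((k : ℝ) + 1) :=
    fun k => h _ (by positivity) _ (by linarith [(Nat.cast_nonneg k : (0 : ℝ) ≤ k)])
  choose s hs hq using h'
  refine ⟨s, fun k => by linarith [hs k, (Nat.cast_nonneg k : (0 : ℝ) ≤ k)], ?_, fun k => 1 / ((k : ℝ) + 1),
    tendsto_one_div_add_atTop_nhds_zero_nat, hq⟩
  have hlin : Tendsto (fun k : ℕ => -((k : ℝ) + 1)) atTop atBot :=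
    tendsto_neg_atTop_atBot.comp (tendsto_atTop_add_const_right atTop (1 : ℝ) tendsto_natCast_atTop_atTop)
  exact tendsto_atBot_mono (fun k => (hs k).le) hlin

/-- **AGEING FLOOR, element form** (PROVED): a NONZERO element has a positive ageing floor on every similarity
ball, for every lag `δ > 0` and every co-motion. -/
theorem hasAgeingFloor_of_ne_zero' (hu : IsTypeIAncientMild C u) (hne : ∃ t < 0, ∃ x, u t x ≠ 0)
    (L : E3 ≃ₗᵢ[ℝ] E3) (b : E3) {δ : ℝ} (hδ : 0 < δ) (η₀ : E3) {ρ : ℝ} (hρ : 0 < ρ) :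
    ∃ f > 0, HasAgeingFloor u L b δ η₀ ρ f := by
  by_contra H
  push Not at H
  have h : ∀ f > (0 : ℝ), ∀ T < (0 : ℝ), ∃ s < T, ∀ z ∈ SilenceMeter.simBall η₀ ρ s, reading L b δ u s z ≤ f := by
    intro f hf T hT
    have h1 : ¬ HasAgeingFloor u L b δ η₀ ρ f := H f hf
    simp only [HasAgeingFloor, not_exists, not_and, not_forall, not_lt] at h1
    obtain ⟨s, hs, hs'⟩ := h1 T hT
    exact ⟨s, hs, hs'⟩
  obtain ⟨s, hrec⟩ := recursAlong_of_forall h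
  obtain ⟨t, ht, x, hx⟩ := hne
  exact hx (eq_zero_of_recursAlong hu hδ hρ hrec t ht x)

/-! ## E. The universal ageing floor (compactness upgrade; the N1 datum) -/

/-- **UNIVERSAL AGEING FLOOR** (PROVED): for every `C`, every co-motion `(L, b)`, every lag `δ > 0` and every
similarity ball `B̄(η₀, ρ)` (`ρ > 0`) there is `f = f(C, L, b, δ, η₀, ρ) > 0` such that NO nonzero `u ∈ A_C` has all its
ageing readings on `√(−s_k)·B̄(η₀, ρ)` below `f` along a sequence `s_k → −∞`.  (Zoom each offender to time `−1` at a
scale beyond its substantiality threshold `substantial_at_large_scales`; a class limit of the zooms is `ε_C`-loud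
at some `(−1, y_∞)`, yet its slice at `−1 − δ`, co-moved, equals its slice at `−1` on `B̄(η₀, ρ)` — impossible by
the exact drift law.) -/
theorem universal_ageing (C : ℝ) (L : E3 ≃ₗᵢ[ℝ] E3) (b : E3) {δ : ℝ} (hδ : 0 < δ) (η₀ : E3) {ρ : ℝ}
    (hρ : 0 < ρ) :
    ∃ f > (0 : ℝ), ∀ u : ℝ → E3 → E3, IsTypeIAncientMild C u → (∃ t < (0 : ℝ), ∃ x, u t x ≠ 0) →
      ∀ s : ℕ → ℝ, (∀ k, s k < 0) → Tendsto s atTop atBot →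
        ∃ k, ∃ z ∈ SilenceMeter.simBall η₀ ρ (s k), f < reading L b δ u (s k) z := by
  by_contra H
  push Not at H
  obtain ⟨ε, hε, K, hK, hsub⟩ := substantial_at_large_scales C
  -- Step 1: for every `n` a class element, `ε`-loud at some `(−1, y)` with `‖y‖ ≤ K`, whose defects on `B̄(η₀, ρ)`
  -- at time `−1` are `≤ 1/(n+1)` (an offender zoomed to a far-past recurrent time beyond its threshold).
  have hn : ∀ n : ℕ, ∃ v : ℝ → E3 → E3, IsTypeIAncientMild C v ∧ (∃ y : E3, ‖y‖ ≤ K ∧ ε < ‖v (-1) y‖) ∧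
      ∀ x ∈ Metric.closedBall η₀ ρ, ‖v (-1 - δ) (L x + b) - L (v (-1) x)‖ ≤ 1 / ((n : ℝ) + 1) := by
    intro n
    obtain ⟨u, hu, hne, s, hs0, hslim, hq⟩ := H (1 / ((n : ℝ) + 1)) (by positivity)
    obtain ⟨μ₁, hμ₁, hloud⟩ := hsub u hu hne
    have hev : ∀ᶠ k in atTop, μ₁ ^ 2 ≤ -s k := (tendsto_neg_atBot_atTop.comp hslim).eventually_ge_atTop _
    obtain ⟨k, hk⟩ := hev.exists
    have hsk : 0 < -s k := by linarith [hs0 k]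
    set μ : ℝ := Real.sqrt (-s k) with hμdef
    have hμpos : 0 < μ := Real.sqrt_pos.2 hsk
    have hμsq : μ ^ 2 = -s k := Real.sq_sqrt hsk.le
    have hμ₁le : μ₁ ≤ μ := by
      calc μ₁ = Real.sqrt (μ₁ ^ 2) := (Real.sqrt_sq hμ₁.le).symm
        _ ≤ Real.sqrt (-s k) := Real.sqrt_le_sqrt hk
    refine ⟨nsRescale μ u, zoom_isTypeIAncientMild hu hμpos, hloud μ hμ₁le, fun x hx => ?_⟩
    have hmem : μ • x ∈ SilenceMeter.simBall η₀ ρ (μ ^ 2 * (-1)) := by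
      have hx' : x ∈ SilenceMeter.simBall η₀ ρ (-1) := by rwa [SilenceMeter.simBall_neg_one]
      exact SilenceMeter.smul_mem_simBall hμpos (by norm_num) hx'
    have ht : μ ^ 2 * (-1 : ℝ) = s k := by rw [hμsq]; ring
    rw [← reading_neg_one, reading_nsRescale L b δ hμpos, ht]
    rw [ht] at hmem
    exact hq k _ hmem
  choose v hv hyv hqv using hn
  choose y hyK hyε using hyv
  -- Step 2: a convergent subsequence of the loud points, then a class limit of the fields along it.
  obtain ⟨yL, -, ψ, hψ, hylim⟩ := (isCompact_closedBall (0 : E3) K).tendsto_subseq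
    (fun n => show y n ∈ Metric.closedBall (0 : E3) K by
      rw [Metric.mem_closedBall, dist_zero_right]; exact hyK n)
  obtain ⟨φ, hφ, V, hV, -, -, hloc, -⟩ :=
    exists_tendsto_of_isTypeIAncientMild_seq C (w := fun j => v (ψ j)) fun j => hv (ψ j)
  -- Step 3: the limit is `ε`-loud at `(−1, yL)` …
  have hL1 : Tendsto (fun j => v (ψ (φ j)) (-1) (y (ψ (φ j)))) atTop (𝓝 (V (-1) yL)) :=
    (hloc (-1) (by norm_num)).tendsto_comp (hV.continuous_slice (by norm_num)).continuousAt
      (hylim.comp hφ.tendsto_atTop)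
  have hVy : ε ≤ ‖V (-1) yL‖ := ge_of_tendsto' hL1.norm fun j => (hyε (ψ (φ j))).le
  -- … and its germ at `−1` recurs from `−1 − δ` modulo the co-motion: the limit is zero, contradiction.
  have hδ' : Tendsto (fun j => 1 / ((ψ (φ j) : ℝ) + 1)) atTop (𝓝 0) :=
    tendsto_one_div_add_atTop_nhds_zero_nat.comp ((hψ.comp hφ).tendsto_atTop)
  have hrec : ∀ x ∈ Metric.closedBall η₀ ρ, L.symm (V (-1 - δ) (L x + b)) = V (-1) x := fun x hx =>
    recurrence_of_tendsto hV hloc L b hδ hδ' fun j => hqv (ψ (φ j)) x hx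
  have hVall : ∀ t < 0, ∀ x, V t x = 0 :=
    eq_zero_of_comotionRecurrent hV L b hδ (t₀ := -1) (by norm_num) Metric.isOpen_ball
      ⟨η₀, Metric.mem_ball_self hρ⟩ fun x hx => hrec x (Metric.ball_subset_closedBall hx)
  rw [hVall (-1) (by norm_num) yL, norm_zero] at hVy
  exact absurd hVy (not_le.2 hε)

/-- **UNIVERSAL AGEING FLOOR, every-time form** (PROVED): with the universal level `f` of `universal_ageing`, every
NONZERO `u ∈ A_C` has the ageing floor `f` on `B̄(η₀, ρ)` at EVERY time before some `T(u) < 0`. -/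
theorem hasAgeingFloor_of_ne_zero (C : ℝ) (L : E3 ≃ₗᵢ[ℝ] E3) (b : E3) {δ : ℝ} (hδ : 0 < δ) (η₀ : E3) {ρ : ℝ}
    (hρ : 0 < ρ) :
    ∃ f > (0 : ℝ), ∀ u : ℝ → E3 → E3, IsTypeIAncientMild C u → (∃ t < (0 : ℝ), ∃ x, u t x ≠ 0) →
      HasAgeingFloor u L b δ η₀ ρ f := by
  obtain ⟨f, hf, hfl⟩ := universal_ageing C L b hδ η₀ hρ
  refine ⟨f, hf, fun u hu hne => ?_⟩
  by_contra H
  simp only [HasAgeingFloor, not_exists, not_and, not_forall, not_lt] at H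
  have h' : ∀ k : ℕ, ∃ s < -((k : ℝ) + 1), ∀ z ∈ SilenceMeter.simBall η₀ ρ s, reading L b δ u s z ≤ f := by
    intro k
    obtain ⟨s, hs, hs'⟩ := H (-((k : ℝ) + 1)) (by linarith [(Nat.cast_nonneg k : (0 : ℝ) ≤ k)])
    exact ⟨s, hs, hs'⟩
  choose s hs hq using h'
  have hs0 : ∀ k, s k < 0 := fun k => by linarith [hs k, (Nat.cast_nonneg k : (0 : ℝ) ≤ k)]
  have hlin : Tendsto (fun k : ℕ => -((k : ℝ) + 1)) atTop atBot :=
    tendsto_neg_atTop_atBot.comp (tendsto_atTop_add_const_right atTop (1 : ℝ) tendsto_natCast_atTop_atTop)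
  have hslim : Tendsto s atTop atBot := tendsto_atBot_mono (fun k => (hs k).le) hlin
  obtain ⟨k, z, hz, hlt⟩ := hfl u hu hne s hs0 hslim
  exact absurd (hq k z hz) (not_le.2 hlt)

end Summit.NavierStokesRegularity.NavierStokesRegularity.Theorems.ScenarioCensus.AgeingMeter

end
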